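/-
Copyright (c) 2026 the pub-hodgecm-mathlib formalisation cell (harness21).  Prover seat hodgecm-mathlib-K2E3-p14 (g9), Track B «K2-LIT» ∕ h413 =
`stmt-HodgeConjecture-24833`, line `K2_E3_EllipticInputs`, unit U4 «Keys», PART «U4Keys» socket :182 (U4f-χ₁-ram-one-pos), programme A_pos^{<}
(default offer BY NAME on the K2 bus 2026-09-04T22:20:52Z after ★ p862387 ∕ ★ p862455; LINE-LEAD K2E3-plan (g5)): brick (v)-CM^{<} «THE CONCAVE-EXPONENT LEVEL DATUM
ON `U(Φ₃)(L⁺_v)`» — the twin of ★ `K2E3IwahoriLevelNLettersCM` (K2E3-p37 (g0), uniform `J_n`) for the letter pair `(Jg, hJg)` of ★ `K2E3IwahoriTwoDepthFactorisation`.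
REPORT-FIRST 2026-09-04.
-/
import Summits.HodgeConjecture.HodgeConjecture.Theorems.K2E3IwahoriLevelNLettersCM         -- ★ p861811 (K2E3-p37): the template; brings the (G3) frame ★ `K2E3BranchATypeLettersCM`, ★ `K2E3IwahoriDatumPrepend`,
                                                                                           --   ★ `K2E3IwahoriLevelDatumPF`, ★ `StructureTransport`, ★ `K2E3IwahoriDetection`, ★ `UnitaryLatticeTree` (compact-open `K₀`)
import Summits.HodgeConjecture.HodgeConjecture.Theorems.K2E3IwahoriTwoDepthFactorisation   -- ★ p862387 (this seat): `le_glInt_subgroupOf`, `forall_v_le_one_of_test`, `coe_eq_mul` (Iwahori factorisation of `Jg`)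
import HarnessLib

/-!
# K2 ∕ E3 «EllipticInputs», unit U4 «Keys» — (U4f-χ₁-ram-one-pos), programme A_pos^{<} brick (v)-CM^{<}: AN IWAHORI DATUM FOR `cmBorelTriple L 3 v` WHOSE FIRST LEVEL IS
# A CONCAVE-EXPONENT LEVEL GROUP `eA⁻¹(J_e)` (Roche's `J_χ`; second level `I`, `N̄ = eA⁻¹(w N_w w)`, same ray)   [Casselman1995 Prop. 1.4.4; BruhatTits1972 (4.4.3)–(4.4.4), §6.4; Roche1998 §2–§3]

Cell hodgecm-mathlib, Track B «K2-LIT», crux item H413 = stmt-HodgeConjecture-24833 (route `HCCMUnconditional`, no route verbs); serves BY NAME the OPEN tier-0 leaf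
`…K2E3EllipticInputs.U4Keys.sig_K2E3KeysThmTwoContractingRamifiedCharOnePosDepth` (U4Keys :182), design D-I «vanishing functional» at POSITIVE depth in the regime A_pos^{<}
(K2E3-p37 (g0) memo §9).  Author K2E3-p14 (g9).  `--supports stmt-HodgeConjecture-24833 --as helper`; THEOREMS ONLY (no `def` ∕ `instance` ∕ `notation` ∕ named fact ∕ `sorry`).
Frame = the (G3)-EXPLICIT frame of ★ `K2E3BranchATypeLettersCM` (`L v w hw eA heA ϖ hϖ g₁ hg₁ K0 K1 I hK0 hK1 hI`) plus the LEVEL LETTERS `e Jg hJg Je hJe`: an exponent matrix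
`e : Fin 3 → Fin 3 → ℕ`, a model subgroup `Jg ≤ U_w` with `hJg : ∀ k, k ∈ Jg ↔ ∀ i j, |kᵢⱼ| ≤ |ϖ|^{e i j}` (★ p862387 `exists_subgroup_forall_mem_iff[_twoDepth]` produces it for every
concave `e`, in particular Roche's two-depth `![![0,r,s],![r',0,r],![s',r',0]]`), and its pull-back `Je = eA⁻¹(Jg)` (`hJe`).  NOT THE PAYER of :182.

THE POINT.  The positive-depth Branch-A assembly consumes an Iwahori datum `𝓘` of `cmBorelTriple L 3 v` whose FIRST level carries the type vector; in the regime A_pos^{<} that level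
is Roche's asymmetric `J_χ` (★ p862387), not the uniform `J_n` of the template ★ p861811.  §1 (model, any `e` with `e i i = 0`, anti-transpose symmetry, N̄-side in `𝔭`): `Jg` is
OPEN (each entry condition `|kᵢⱼ| ≤ |ϖ|^{e i j}` is `(ϖ^{e i j})⁻¹kᵢⱼ ∈ 𝒪`, the preimage of the open `𝒪` under a continuous map), COMPACT (an open hence closed subgroup of the compact
`K₀` ★ `UnitaryLatticeTree.isCompact_glInt_subgroupOf`), and `Jg ≤ I` (the Iwahori test ★ `mem_glInt_inf_conj_glInt_iff`: `|ϖ|^{e} < 1` on the three lower entries).  §2 (CM) repeats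
the template's construction VERBATIM with `J_n ↦ Jg`: the model datum at level `I` (★ `K2E3IwahoriLevelDatumPF.exists_iwahoriDatum_iwahoriLevel`, ray `d(ϖ, 1, (σϖ)⁻¹)`), the compact
open `Jg` PREPENDED (★ `K2E3IwahoriDatumPrepend.exists_iwahoriDatum_prepend`; factorisation ★ p862387 `coe_eq_mul` relative to the datum's `N̄ = w N_w w`), pulled back along `eA`
(★ `StructureTransport.exists_iwahoriDatum_comap`; Levi ∕ radical clauses ★ `K2E3IwahoriDetection.eA_mem_torusU_iff` ∕ `eA_mem_unipotentU_iff`).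
* §1 (model) `isOpen_coe_of_forall_mem_iff`, `isCompact_coe_of_forall_mem_iff`, `le_inf_conj_of_forall_mem_iff` (`Jg ≤ I`).
* §2 (CM, (G3) frame) **`exists_iwahoriDatum_K_zero_eq_levelGroup`** — `∃ 𝓘 : (cmBorelTriple L 3 v).IwahoriDatum, 𝓘.K 0 = Je ∧ 𝓘.K 1 = I ∧ 𝓘.Nbar = (N_w.map (conj w)).comap eA`.
HONEST LABEL: HC_CM is proved only modulo the 7 printed citations (2 remaining named inputs: hLiu418 = stmt-HodgeConjecture-24832, h413 = stmt-HodgeConjecture-24833)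
until rung 0 closes; count-neutral — this file does NOT pay the leaf; no printed citation is discharged.

## References
* [Casselman1995] W. Casselman, *Introduction to the theory of admissible representations of `p`-adic reductive groups* (1995), Prop. 1.4.4, Thm. 3.3.3.
* [BruhatTits1972] F. Bruhat, J. Tits, *Groupes réductifs sur un corps local I*, Publ. Math. IHÉS 41 (1972), (4.4.3)–(4.4.4), §6.4.
* [Roche1998] A. Roche, *Types and Hecke algebras for principal series representations of split reductive p-adic groups*, Ann. Sci. ÉNS (4) 31 (1998), §2–§3.
* [Tits1979] J. Tits, *Reductive groups over local fields*, Proc. Symp. Pure Math. 33.1 (1979), §3.2, §3.7 (compact open parahorics).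
* [PlatonovRapinchuk1994] V. Platonov, A. Rapinchuk, *Algebraic Groups and Number Theory* (1994), §5.1 (the one-place model at a non-split place).
-/

set_option autoImplicit false
-- the mandated namespace has the single-problem summit's repeated segment (`HodgeConjecture.HodgeConjecture`)
set_option linter.dupNamespace false

noncomputable section

open NumberField IsDedekindDomain MeasureTheory ValuativeRel
open scoped Matrix MatrixGroups WithZero Valued Pointwise
open Literature.NumberTheory Literature.NumberTheory.Automorphic Literature.NumberTheory.Automorphic.UnitaryGroup
open Literature.NumberTheory.Rogawski1990

namespace Summit.HodgeConjecture.HodgeConjecture.Cruxes.H413.K2E3IwahoriTwoDepthLettersCM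

open Summit.HodgeConjecture.HodgeConjecture.Cruxes.H413

/-! ## §1 Model: `Jg` is compact open and `Jg ≤ I` -/

section Model

variable {K : Type*} [Field K] [Valued K ℤᵐ⁰] [ValuativeRel K] [(Valued.v : Valuation K ℤᵐ⁰).Compatible]
  (σ : K →+* K) {ϖ : K} {J : Matrix (Fin 3) (Fin 3) K} (hJ : J = (StdForm.antidiagonal 3).over K)
  (hvσ : ∀ a, Valued.v (σ a) = Valued.v a) (hvϖ : Valued.v ϖ = WithZero.exp (-1 : ℤ))
  (g₁ : GL (Fin 3) K) (hg₁ : (g₁ : Matrix (Fin 3) (Fin 3) K) = Matrix.diagonal ![(1 : K), 1, ϖ])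
  (e : Fin 3 → Fin 3 → ℕ) (Jg : Subgroup ↥(unitaryGroupOfForm σ J))
  (hJg : ∀ k, k ∈ Jg ↔ ∀ i j, Valued.v (((k : GL (Fin 3) K) : Matrix (Fin 3) (Fin 3) K) i j) ≤ Valued.v ϖ ^ e i j)

omit [ValuativeRel K] [(Valued.v : Valuation K ℤᵐ⁰).Compatible] in
include hvϖ hJg in
/-- **`Jg` is OPEN in `U(σ, Φ₃)(K)`**: the condition `|kᵢⱼ| ≤ |ϖ|^{e i j}` is `(ϖ^{e i j})⁻¹·kᵢⱼ ∈ 𝒪` (★ `v_pow_inv_mul_le_iff`), the preimage of the open `𝒪` (`Valued.isOpen_integer`)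
under a continuous map (entries are continuous on `U ≤ GL₃(K)`); finitely many such conditions. [cite: Tits1979, §3.2] [cite: BruhatTits1972, §6.4] -/
theorem isOpen_coe_of_forall_mem_iff : IsOpen ((Jg : Subgroup ↥(unitaryGroupOfForm σ J)) : Set ↥(unitaryGroupOfForm σ J)) := by
  have hϖ0 : ϖ ≠ 0 := CartanUnique.uniformizer_ne_zero hvϖ
  have hset : ((Jg : Subgroup ↥(unitaryGroupOfForm σ J)) : Set ↥(unitaryGroupOfForm σ J)) =
      ⋂ i, ⋂ j, (fun u : ↥(unitaryGroupOfForm σ J) => (ϖ ^ e i j)⁻¹ * (((u : GL (Fin 3) K) : Matrix (Fin 3) (Fin 3) K) i j)) ⁻¹' {x : K | Valued.v x ≤ 1} := by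
    ext u
    simp only [SetLike.mem_coe, hJg, Set.mem_iInter, Set.mem_preimage, Set.mem_setOf_eq, K2E3IwahoriLevelNFactorisation.v_pow_inv_mul_le_iff hϖ0]
  rw [hset]
  have hO : IsOpen {x : K | Valued.v x ≤ 1} := Valued.isOpen_integer K
  have hval : Continuous fun u : ↥(unitaryGroupOfForm σ J) => ((u : GL (Fin 3) K) : Matrix (Fin 3) (Fin 3) K) :=
    Units.continuous_val.comp continuous_subtype_val
  exact isOpen_iInter_of_finite fun i => isOpen_iInter_of_finite fun j => hO.preimage (continuous_const.mul (hval.matrix_elem i j))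

include hJ hvσ hvϖ hJg in
/-- **`Jg` is COMPACT** (`σ` continuous, `𝒪` compact): an open — hence closed — subgroup inside the compact `K₀` (★ p862387 `le_glInt_subgroupOf`, ★
`UnitaryLatticeTree.isCompact_glInt_subgroupOf`). [cite: Tits1979, §3.2] [cite: BruhatTits1972, §6.4] -/
theorem isCompact_coe_of_forall_mem_iff [CompactSpace (Valued.integer K)] (hσc : Continuous σ) :
    IsCompact ((Jg : Subgroup ↥(unitaryGroupOfForm σ J)) : Set ↥(unitaryGroupOfForm σ J)) :=
  (UnitaryLatticeTree.isCompact_glInt_subgroupOf σ J hσc).of_isClosed_subset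
    (Subgroup.isClosed_of_isOpen _ (isOpen_coe_of_forall_mem_iff σ hvϖ e Jg hJg))
    (K2E3IwahoriTwoDepthFactorisation.le_glInt_subgroupOf σ hJ hvσ hvϖ e Jg hJg)

include hJ hvσ hvϖ hg₁ hJg in
/-- **`Jg ≤ I = K₀ ⊓ K₁`** as soon as the N̄-side of `e` lies in `𝔭` (`1 ≤ e 1 0`, `1 ≤ e 2 0`, `1 ≤ e 2 1`): the three strictly-lower entries have valuation `≤ |ϖ|^{e} < 1`, which is
the Iwahori test ★ `mem_glInt_inf_conj_glInt_iff`. [cite: BruhatTits1972, (4.4.3)–(4.4.4)] [cite: Roche1998, §2–§3] -/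
theorem le_inf_conj_of_forall_mem_iff (h10 : 1 ≤ e 1 0) (h20 : 1 ≤ e 2 0) (h21 : 1 ≤ e 2 1) :
    Jg ≤ (glInt 3 K).subgroupOf (unitaryGroupOfForm σ J) ⊓ ((glInt 3 K).map (MulAut.conj g₁).toMonoidHom).subgroupOf (unitaryGroupOfForm σ J) := by
  have hvϖ1 : Valued.v ϖ < 1 := by rw [hvϖ, ← WithZero.exp_zero, WithZero.exp_lt_exp]; norm_num
  have hlt : ∀ m : ℕ, 1 ≤ m → Valued.v ϖ ^ m < 1 := fun m hm => pow_lt_one' hvϖ1 (Nat.one_le_iff_ne_zero.1 hm)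
  intro k hk
  have ht := (hJg k).1 hk
  exact (mem_glInt_inf_conj_glInt_iff σ hJ hvσ hvϖ g₁ hg₁ k).2 ⟨K2E3IwahoriTwoDepthFactorisation.forall_v_le_one_of_test σ hvϖ e ht,
    (ht 2 0).trans_lt (hlt _ h20), (ht 2 1).trans_lt (hlt _ h21), (ht 1 0).trans_lt (hlt _ h10)⟩

end Model

/-! ## §2 CM: an Iwahori datum with `K 0 = eA⁻¹(Jg)`, `K 1 = I`, `N̄ = eA⁻¹(w N_w w)` -/

section CM

variable (L : Type) [Field L] [NumberField L] [IsCMField L] (v : HeightOneSpectrum (𝓞 ↥(maximalRealSubfield L)))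
  (w : PlacesOver L v) (hw : IsCMField.complexConj L • w.1 = w.1)
  (eA : Gqs L v ≃ₜ* ↥(unitaryGroupOfForm (galAdicCompletionMap (L := L) (IsCMField.complexConj L) hw) ((StdForm.antidiagonal 3).over (w.1.adicCompletion L))))
  (heA : ∀ g : Gqs L v,
    ((eA g : ↥(unitaryGroupOfForm (galAdicCompletionMap (L := L) (IsCMField.complexConj L) hw) ((StdForm.antidiagonal 3).over (w.1.adicCompletion L)))) :
        GL (Fin 3) (w.1.adicCompletion L)) =
      ((localNonsplitEquiv (IsCMField.complexConj L) (qsForm L) (IsCMField.complexConj_ne_one L) w hw g :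
        ↥(unitaryGroupOfForm (galAdicCompletionMap (L := L) (IsCMField.complexConj L) hw) (placeForm (qsForm L) w.1))) : GL (Fin 3) (w.1.adicCompletion L)))
  {ϖ : w.1.adicCompletion L} (hϖ : Valued.v ϖ = WithZero.exp (-1 : ℤ))
  (g₁ : GL (Fin 3) (w.1.adicCompletion L)) (hg₁ : (g₁ : Matrix (Fin 3) (Fin 3) (w.1.adicCompletion L)) = Matrix.diagonal ![(1 : w.1.adicCompletion L), 1, ϖ])
  (K0 K1 I : Subgroup (Gqs L v))
  (hK0 : K0 = ((glInt 3 (w.1.adicCompletion L)).subgroupOf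
    (unitaryGroupOfForm (galAdicCompletionMap (L := L) (IsCMField.complexConj L) hw) ((StdForm.antidiagonal 3).over (w.1.adicCompletion L)))).comap
      eA.toMulEquiv.toMonoidHom)
  (hK1 : K1 = (((glInt 3 (w.1.adicCompletion L)).map (MulAut.conj g₁).toMonoidHom).subgroupOf
    (unitaryGroupOfForm (galAdicCompletionMap (L := L) (IsCMField.complexConj L) hw) ((StdForm.antidiagonal 3).over (w.1.adicCompletion L)))).comap
      eA.toMulEquiv.toMonoidHom)
  (hI : I = K0 ⊓ K1)
  (e : Fin 3 → Fin 3 → ℕ)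
  (Jg : Subgroup ↥(unitaryGroupOfForm (galAdicCompletionMap (L := L) (IsCMField.complexConj L) hw) ((StdForm.antidiagonal 3).over (w.1.adicCompletion L))))
  (hJg : ∀ k, k ∈ Jg ↔ ∀ i j, Valued.v (((k : GL (Fin 3) (w.1.adicCompletion L)) : Matrix (Fin 3) (Fin 3) (w.1.adicCompletion L)) i j) ≤ Valued.v ϖ ^ e i j)
  (Je : Subgroup (Gqs L v)) (hJe : Je = Jg.comap eA.toMulEquiv.toMonoidHom)

include heA hϖ hg₁ hK0 hK1 hI hJg hJe in
set_option maxHeartbeats 400000 in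
-- MEASURED: the default 200000 times out at `whnf` (the ray data, the prepended level and the transport clauses); 400000 suffices (the template used 1600000)
-- adapted from ★ `K2E3IwahoriLevelNLettersCM.exists_iwahoriDatum_K_zero_eq_levelN` (K2E3-p37 (g0)): the level `J_n` is replaced by the letter pair `(Jg, hJg)`
/-- **THE CONCAVE-EXPONENT LEVEL DATUM ON `U(Φ₃)(L⁺_v)`**: for an exponent matrix `e` with `e i i = 0`, the anti-transpose symmetry and its N̄-side in `𝔭` (`1 ≤ e 1 0`, `1 ≤ e 2 0`),
and a model level group `Jg` with `hJg` (★ p862387; Roche's two-depth `J_χ` included), there is an Iwahori datum `𝓘` for `cmBorelTriple L 3 v` with `𝓘.K 0 = Je = eA⁻¹(Jg)` (letter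
`hJe`), `𝓘.K 1 = I` AND `𝓘.N̄ = eA⁻¹(N_w.map (conj w))` — the model datum at level `I` (★ `exists_iwahoriDatum_iwahoriLevel`, ray `d(ϖ, 1, (σϖ)⁻¹)`) with the compact open `Jg`
PREPENDED (§1; ★ `exists_iwahoriDatum_prepend`; factorisation ★ p862387 `coe_eq_mul`), pulled back along `eA` (★ `StructureTransport.exists_iwahoriDatum_comap`).  This is the datum the
A_pos^{<} assembly feeds to ★ Z2A-2 and ★ V2b (with `hθmul` := ★ p862455). [cite: Casselman1995, Prop. 1.4.4, Thm. 3.3.3] [cite: BruhatTits1972, (4.4.4), §6.4] [cite: Roche1998, §2–§3]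
[cite: PlatonovRapinchuk1994, §5.1] -/
theorem exists_iwahoriDatum_K_zero_eq_levelGroup (he0 : ∀ i, e i i = 0) (hsym : ∀ i j, e (Fin.rev j) (Fin.rev i) = e i j)
    (h10 : 1 ≤ e 1 0) (h20 : 1 ≤ e 2 0) :
    ∃ 𝓘 : (cmBorelTriple L 3 v).IwahoriDatum, 𝓘.K 0 = Je ∧ 𝓘.K 1 = I ∧
      𝓘.Nbar = (((borelTriple (galAdicCompletionMap (L := L) (IsCMField.complexConj L) hw) ((StdForm.antidiagonal 3).over (w.1.adicCompletion L)) rfl).N).map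
        (MulAut.conj (weylLongU (galAdicCompletionMap (L := L) (IsCMField.complexConj L) hw)
          (rfl : (StdForm.antidiagonal 3).over (w.1.adicCompletion L) = _))).toMonoidHom).comap
        (eA : Gqs L v →* ↥(unitaryGroupOfForm (galAdicCompletionMap (L := L) (IsCMField.complexConj L) hw) ((StdForm.antidiagonal 3).over (w.1.adicCompletion L)))) := by
  haveI : CompactSpace (Valued.integer (w.1.adicCompletion L)) := compactSpace_integer_adicCompletion L w.1
  have hσσ := (galAdicCompletionMap_galAdicCompletionMap_of_smul_eq (IsCMField.complexConj L) w (IsCMField.complexConj_ne_one L) hw)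
  have hσc : Continuous (galAdicCompletionMap (L := L) (IsCMField.complexConj L) hw) := continuous_galAdicCompletionMap (L := L) (IsCMField.complexConj L) hw
  have hvσ : ∀ a, Valued.v (galAdicCompletionMap (L := L) (IsCMField.complexConj L) hw a) = Valued.v a :=
    fun a => valued_galAdicCompletionMap (L := L) (IsCMField.complexConj L) hw a
  have hϖ0 : ϖ ≠ 0 := CartanUnique.uniformizer_ne_zero hϖ
  have hσϖ0 : galAdicCompletionMap (L := L) (IsCMField.complexConj L) hw ϖ ≠ 0 := (map_ne_zero _).2 hϖ0
  have h21 : 1 ≤ e 2 1 := by rw [show e 2 1 = e 1 0 from hsym 1 0]; exact h10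
  -- the ray `s = d(ϖ, 1, (σϖ)⁻¹)` and its ratio data (as in the template)
  obtain ⟨s, -, hs⟩ := exists_coe_eq_diag (galAdicCompletionMap (L := L) (IsCMField.complexConj L) hw)
    (rfl : (StdForm.antidiagonal 3).over (w.1.adicCompletion L) = _) hσσ hϖ0 (β := 1) (by rw [map_one, mul_one])
  have hvσϖ : valuation (w.1.adicCompletion L) (galAdicCompletionMap (L := L) (IsCMField.complexConj L) hw ϖ) = valuation (w.1.adicCompletion L) ϖ :=
    (v_eq_iff_valuation_eq _ _).1 (hvσ ϖ)
  have hq0 : valuation (w.1.adicCompletion L) ϖ ≠ 0 := (Valuation.ne_zero_iff _).2 hϖ0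
  have hq1 : valuation (w.1.adicCompletion L) ϖ < 1 := by
    rw [← v_lt_one_iff_valuation_lt_one, hϖ, ← WithZero.exp_zero, WithZero.exp_lt_exp]; norm_num
  set u : Fin 3 → (w.1.adicCompletion L)ˣ := ![Units.mk0 ϖ hϖ0, 1, (Units.mk0 _ hσϖ0)⁻¹] with hu_def
  have hu0 : ((u 0 : (w.1.adicCompletion L)ˣ) : w.1.adicCompletion L) = ϖ := by simp only [hu_def, Matrix.cons_val_zero, Units.val_mk0]
  have hu1 : ((u 1 : (w.1.adicCompletion L)ˣ) : w.1.adicCompletion L) = 1 := by simp only [hu_def, Matrix.cons_val_one, Matrix.cons_val_zero, Units.val_one]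
  have hu2 : ((u 2 : (w.1.adicCompletion L)ˣ) : w.1.adicCompletion L) = (galAdicCompletionMap (L := L) (IsCMField.complexConj L) hw ϖ)⁻¹ := by
    simp only [hu_def, Matrix.cons_val_two, Matrix.tail_cons, Matrix.head_cons, Units.val_inv_eq_inv_val, Units.val_mk0]
  have hsu : ((s : ↥(unitaryGroupOfForm (galAdicCompletionMap (L := L) (IsCMField.complexConj L) hw) ((StdForm.antidiagonal 3).over (w.1.adicCompletion L)))) :
      GL (Fin 3) (w.1.adicCompletion L)) = glDiagonal 3 (w.1.adicCompletion L) u := by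
    refine Units.ext ?_
    rw [hs, coe_glDiagonal]
    ext i j
    fin_cases i <;> fin_cases j <;> simp [hu0, hu1, hu2, Matrix.diagonal]
  have hu : ∀ i j : Fin 3, i < j → valuation (w.1.adicCompletion L) ((u i : w.1.adicCompletion L) * ((u j : w.1.adicCompletion L))⁻¹) ≤
      valuation (w.1.adicCompletion L) ϖ := by
    intro i j hij
    fin_cases i <;> fin_cases j
    all_goals first | exact absurd hij (by decide) | skip
    · show valuation _ (((u 0 : (w.1.adicCompletion L)ˣ) : w.1.adicCompletion L) * (((u 1 : (w.1.adicCompletion L)ˣ) : w.1.adicCompletion L))⁻¹) ≤ _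
      rw [hu0, hu1, inv_one, mul_one]
    · show valuation _ (((u 0 : (w.1.adicCompletion L)ˣ) : w.1.adicCompletion L) * (((u 2 : (w.1.adicCompletion L)ˣ) : w.1.adicCompletion L))⁻¹) ≤ _
      rw [hu0, hu2, inv_inv, map_mul, hvσϖ]
      calc valuation _ ϖ * valuation _ ϖ ≤ valuation _ ϖ * 1 := mul_le_mul' le_rfl hq1.le
        _ = valuation _ ϖ := mul_one _
    · show valuation _ (((u 1 : (w.1.adicCompletion L)ˣ) : w.1.adicCompletion L) * (((u 2 : (w.1.adicCompletion L)ˣ) : w.1.adicCompletion L))⁻¹) ≤ _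
      rw [hu1, hu2, inv_inv, one_mul, hvσϖ]
  -- the model datum at level `I`, with its `N̄` clause
  obtain ⟨𝓘', -, hNbar', hK0', -⟩ := K2E3IwahoriLevelDatumPF.exists_iwahoriDatum_iwahoriLevel L v w hw hϖ g₁ hg₁ hq0 hq1 s u hsu hu
  -- PREPEND the compact open `Jg` (model, §1)
  have hJo := isOpen_coe_of_forall_mem_iff (galAdicCompletionMap (L := L) (IsCMField.complexConj L) hw) hϖ e Jg hJg
  have hJc := isCompact_coe_of_forall_mem_iff (galAdicCompletionMap (L := L) (IsCMField.complexConj L) hw)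
    (rfl : (StdForm.antidiagonal 3).over (w.1.adicCompletion L) = _) hvσ hϖ e Jg hJg hσc
  have hle : Jg ≤ 𝓘'.K 0 := by
    rw [hK0']
    exact le_inf_conj_of_forall_mem_iff (galAdicCompletionMap (L := L) (IsCMField.complexConj L) hw) rfl hvσ hϖ g₁ hg₁ e Jg hJg h10 h20 h21
  have hfac := K2E3IwahoriTwoDepthFactorisation.coe_eq_mul (galAdicCompletionMap (L := L) (IsCMField.complexConj L) hw)
    (rfl : (StdForm.antidiagonal 3).over (w.1.adicCompletion L) = _) hσσ hvσ hϖ e Jg hJg he0 hsym h10 h20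
  rw [← hNbar'] at hfac
  obtain ⟨𝓘'', hK0'', hNbar'', -, hKsucc''⟩ := K2E3IwahoriDatumPrepend.exists_iwahoriDatum_prepend _ 𝓘' _ hJo hJc hle hfac
  -- the transport clauses
  have hM : ((borelTriple (galAdicCompletionMap (L := L) (IsCMField.complexConj L) hw) ((StdForm.antidiagonal 3).over (w.1.adicCompletion L)) rfl).M).comap
      (eA : Gqs L v →* ↥(unitaryGroupOfForm (galAdicCompletionMap (L := L) (IsCMField.complexConj L) hw) ((StdForm.antidiagonal 3).over (w.1.adicCompletion L)))) =
      (cmBorelTriple L 3 v).M := by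
    ext g
    rw [Subgroup.mem_comap, borelTriple_M]
    exact K2E3IwahoriDetection.eA_mem_torusU_iff L v w hw eA heA g
  have hN : ((borelTriple (galAdicCompletionMap (L := L) (IsCMField.complexConj L) hw) ((StdForm.antidiagonal 3).over (w.1.adicCompletion L)) rfl).N).comap
      (eA : Gqs L v →* ↥(unitaryGroupOfForm (galAdicCompletionMap (L := L) (IsCMField.complexConj L) hw) ((StdForm.antidiagonal 3).over (w.1.adicCompletion L)))) =
      (cmBorelTriple L 3 v).N := by
    ext g
    rw [Subgroup.mem_comap, borelTriple_N]
    exact K2E3IwahoriDetection.eA_mem_unipotentU_iff L v w hw eA heA g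
  obtain ⟨𝓘, hNbar, -, hK⟩ := StructureTransport.exists_iwahoriDatum_comap eA (cmBorelTriple L 3 v)
    (borelTriple (galAdicCompletionMap (L := L) (IsCMField.complexConj L) hw) ((StdForm.antidiagonal 3).over (w.1.adicCompletion L)) rfl) hM hN 𝓘''
  refine ⟨𝓘, ?_, ?_, ?_⟩
  · rw [hK 0, hK0'', hJe]
    rfl
  · rw [hK 1, hKsucc'' 0, hK0', hI, hK0, hK1, ← Subgroup.comap_inf]
    rfl
  · rw [hNbar, hNbar'', hNbar']

end CM

end Summit.HodgeConjecture.HodgeConjecture.Cruxes.H413.K2E3IwahoriTwoDepthLettersCM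

end
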